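import Mathlib

/-!
# Crux `TwSeededEnsembleEquivalenceR` (stmt-HubbardSuperconductivity-15581), line `cold-floor-collapse`
# (slug `Sketch`) — stub S1 `stub_danskinEnvelope`: the convex Danskin / envelope theorem

Support file (`--supports stmt-HubbardSuperconductivity-15581`; sorry-free; no definition; pure real analysis).
For `q : ℝ → ℝ → ℝ`, `H ≥ 0`, `S = [−H, H]`: if `μ ↦ q μ h` is convex for `h ∈ S`, `q` is Lipschitz in `μ`
and in `h ∈ S`, and at `μ₀` every maximiser `h ∈ S` of `h ↦ q μ₀ h − h²/g` has `HasDerivAt (q · h) d μ₀`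
with ONE common slope `d`, then `B(μ) = sSup_{h ∈ S}[q μ h − h²/g]` has `HasDerivAt B d μ₀`.
Proof: maximisers exist (extreme value theorem); lower bounds on the one-sided quotients of `B` from one
maximiser at `μ₀`; upper bounds from a maximiser `h_μ` at `μ`, convexity (secant over `[μ₀, μ]` ≤ secant
over `[μ₀, μ₀+τ]`), and compactness: along a bad sequence `μₙ → μ₀` a subsequence of `h_{μₙ}` converges to
a maximiser at `μ₀`, whose short secant is close to `d`. In the line: `q` = infinite-volume SOURCED pressure
at the cold slice, `B` = infinite-volume SEEDED pressure (AHM formula), `d` = sourced density at the optimal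
sources. Danskin (1966); Hiriart-Urruty–Lemaréchal, Convex Analysis and Minimization Algorithms I,
Thm VI.4.4.2. [folklore]
-/

set_option linter.dupNamespace false

namespace Summit.HubbardSuperconductivity.HubbardSuperconductivity.Theorems.TwSeededEnsembleEquivalenceR.ColdFloorLine

open Filter Topology Set

noncomputable section

/-! ### Maximisers of `h ↦ q μ h − h²/g` on `[−H, H]` -/

/-- A function that is Lipschitz (with any real constant) on a set is continuous on it. [folklore] -/
theorem danskin_continuousOn_of_lipschitz {f : ℝ → ℝ} {S : Set ℝ} {C : ℝ}
    (hf : ∀ h ∈ S, ∀ h' ∈ S, |f h - f h'| ≤ C * |h - h'|) : ContinuousOn f S := by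
  rw [Metric.continuousOn_iff]
  intro b hb ε hε
  refine ⟨ε / (max C 0 + 1), by positivity, fun a ha hab => ?_⟩
  rw [Real.dist_eq] at hab ⊢
  have hC : C ≤ max C 0 + 1 := by linarith [le_max_left C 0]
  have h0 : 0 < max C 0 + 1 := by positivity
  calc |f a - f b| ≤ C * |a - b| := hf a ha b hb
    _ ≤ (max C 0 + 1) * |a - b| := mul_le_mul_of_nonneg_right hC (abs_nonneg _)
    _ < (max C 0 + 1) * (ε / (max C 0 + 1)) := mul_lt_mul_of_pos_left hab h0
    _ = ε := by field_simp

/-- **Maximisers exist** (extreme value theorem on the compact interval `[−H, H]`, `H ≥ 0`): for every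
`μ` some `h ∈ [−H, H]` maximises `h' ↦ q μ h' − h'²/g`, and the supremum `B(μ)` is attained there.
[folklore] -/
theorem danskin_exists_max (q : ℝ → ℝ → ℝ) {H Ch : ℝ} (g : ℝ) (hH : 0 ≤ H)
    (hLh : ∀ (μ : ℝ), ∀ h ∈ Set.Icc (-H) H, ∀ h' ∈ Set.Icc (-H) H, |q μ h - q μ h'| ≤ Ch * |h - h'|)
    (μ : ℝ) :
    ∃ h ∈ Set.Icc (-H) H, (∀ h' ∈ Set.Icc (-H) H, q μ h' - h' ^ 2 / g ≤ q μ h - h ^ 2 / g) ∧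
      sSup ((fun h' : ℝ => q μ h' - h' ^ 2 / g) '' Set.Icc (-H) H) = q μ h - h ^ 2 / g := by
  have hS : IsCompact (Set.Icc (-H) H) := isCompact_Icc
  have hne : (Set.Icc (-H) H).Nonempty := ⟨0, by constructor <;> linarith⟩
  have hcont : ContinuousOn (fun h' : ℝ => q μ h' - h' ^ 2 / g) (Set.Icc (-H) H) :=
    (danskin_continuousOn_of_lipschitz (hLh μ)).sub ((continuous_pow 2).div_const g).continuousOn
  obtain ⟨h, hhS, hmax⟩ := hS.exists_isMaxOn hne hcont
  have hmax' : ∀ h' ∈ Set.Icc (-H) H, q μ h' - h' ^ 2 / g ≤ q μ h - h ^ 2 / g :=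
    fun h' hh' => isMaxOn_iff.mp hmax h' hh'
  refine ⟨h, hhS, hmax', IsGreatest.csSup_eq ⟨⟨h, hhS, rfl⟩, ?_⟩⟩
  rintro _ ⟨h', hh', rfl⟩
  exact hmax' h' hh'

/-- **Joint continuity along sequences**: if `μₙ → μ₀`, `hₙ → h̄` with `hₙ, h̄ ∈ [−H, H]`, then
`q μₙ hₙ − hₙ²/g → q μ₀ h̄ − h̄²/g` (both Lipschitz bounds). [folklore] -/
theorem danskin_tendsto_payoff (q : ℝ → ℝ → ℝ) {H Cμ Ch : ℝ} (g : ℝ)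
    (hLμ : ∀ (μ μ' : ℝ), ∀ h ∈ Set.Icc (-H) H, |q μ h - q μ' h| ≤ Cμ * |μ - μ'|)
    (hLh : ∀ (μ : ℝ), ∀ h ∈ Set.Icc (-H) H, ∀ h' ∈ Set.Icc (-H) H, |q μ h - q μ h'| ≤ Ch * |h - h'|)
    {μs : ℕ → ℝ} {hs : ℕ → ℝ} {μ₀ hbar : ℝ} (hμs : Tendsto μs atTop (𝓝 μ₀))
    (hhs : Tendsto hs atTop (𝓝 hbar)) (hhsS : ∀ n, hs n ∈ Set.Icc (-H) H)
    (hbarS : hbar ∈ Set.Icc (-H) H) :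
    Tendsto (fun n => q (μs n) (hs n) - hs n ^ 2 / g) atTop (𝓝 (q μ₀ hbar - hbar ^ 2 / g)) := by
  have hpen : Tendsto (fun n => hs n ^ 2 / g) atTop (𝓝 (hbar ^ 2 / g)) :=
    (((continuous_pow 2).div_const g).tendsto hbar).comp hhs
  refine Tendsto.sub ?_ hpen
  rw [Metric.tendsto_atTop] at hμs hhs ⊢
  intro ε hε
  set K : ℝ := max Cμ 0 + max Ch 0 + 1 with hK
  have hK0 : 0 < K := by positivity
  obtain ⟨N₁, hN₁⟩ := hμs (ε / (2 * K)) (by positivity)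
  obtain ⟨N₂, hN₂⟩ := hhs (ε / (2 * K)) (by positivity)
  refine ⟨max N₁ N₂, fun n hn => ?_⟩
  have h1 := hN₁ n ((le_max_left _ _).trans hn)
  have h2 := hN₂ n ((le_max_right _ _).trans hn)
  rw [Real.dist_eq] at h1 h2 ⊢
  have hA : |q (μs n) (hs n) - q μ₀ (hs n)| ≤ K * |μs n - μ₀| := by
    calc |q (μs n) (hs n) - q μ₀ (hs n)| ≤ Cμ * |μs n - μ₀| := hLμ _ _ _ (hhsS n)
      _ ≤ K * |μs n - μ₀| := by
          apply mul_le_mul_of_nonneg_right _ (abs_nonneg _)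
          linarith [le_max_left Cμ 0, le_max_right Ch 0, le_max_left Ch 0]
  have hB : |q μ₀ (hs n) - q μ₀ hbar| ≤ K * |hs n - hbar| := by
    calc |q μ₀ (hs n) - q μ₀ hbar| ≤ Ch * |hs n - hbar| := hLh _ _ (hhsS n) _ hbarS
      _ ≤ K * |hs n - hbar| := by
          apply mul_le_mul_of_nonneg_right _ (abs_nonneg _)
          linarith [le_max_left Cμ 0, le_max_right Cμ 0, le_max_left Ch 0]
  have hA' : K * |μs n - μ₀| < K * (ε / (2 * K)) := mul_lt_mul_of_pos_left h1 hK0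
  have hB' : K * |hs n - hbar| < K * (ε / (2 * K)) := mul_lt_mul_of_pos_left h2 hK0
  have hKK : K * (ε / (2 * K)) = ε / 2 := by field_simp
  calc |q (μs n) (hs n) - q μ₀ hbar|
      = |(q (μs n) (hs n) - q μ₀ (hs n)) + (q μ₀ (hs n) - q μ₀ hbar)| := by ring_nf
    _ ≤ |q (μs n) (hs n) - q μ₀ (hs n)| + |q μ₀ (hs n) - q μ₀ hbar| := abs_add_le _ _
    _ < ε / 2 + ε / 2 := by linarith
    _ = ε := by ring

/-- **Limits of maximisers are maximisers**: if `μₙ → μ₀`, `hₙ ∈ [−H, H]` maximises the payoff at `μₙ`,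
and `hₙ → h̄`, then `h̄` maximises the payoff at `μ₀` and the supremum `B(μ₀)` equals the payoff at `h̄`.
[folklore] -/
theorem danskin_limit_isMax (q : ℝ → ℝ → ℝ) {H Cμ Ch : ℝ} (g : ℝ) (hH : 0 ≤ H)
    (hLμ : ∀ (μ μ' : ℝ), ∀ h ∈ Set.Icc (-H) H, |q μ h - q μ' h| ≤ Cμ * |μ - μ'|)
    (hLh : ∀ (μ : ℝ), ∀ h ∈ Set.Icc (-H) H, ∀ h' ∈ Set.Icc (-H) H, |q μ h - q μ h'| ≤ Ch * |h - h'|)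
    {μs : ℕ → ℝ} {hs : ℕ → ℝ} {μ₀ hbar : ℝ} (hμs : Tendsto μs atTop (𝓝 μ₀))
    (hhs : Tendsto hs atTop (𝓝 hbar)) (hhsS : ∀ n, hs n ∈ Set.Icc (-H) H)
    (hbarS : hbar ∈ Set.Icc (-H) H)
    (hmaxn : ∀ n, ∀ h' ∈ Set.Icc (-H) H, q (μs n) h' - h' ^ 2 / g ≤ q (μs n) (hs n) - hs n ^ 2 / g) :
    (∀ h' ∈ Set.Icc (-H) H, q μ₀ h' - h' ^ 2 / g ≤ q μ₀ hbar - hbar ^ 2 / g) ∧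
      sSup ((fun h' : ℝ => q μ₀ h' - h' ^ 2 / g) '' Set.Icc (-H) H) = q μ₀ hbar - hbar ^ 2 / g := by
  have hmax : ∀ h' ∈ Set.Icc (-H) H, q μ₀ h' - h' ^ 2 / g ≤ q μ₀ hbar - hbar ^ 2 / g := by
    intro h' hh'
    have hconst : Tendsto (fun _ : ℕ => h') atTop (𝓝 h') := tendsto_const_nhds
    have ha := danskin_tendsto_payoff q g hLμ hLh hμs hconst (fun _ => hh') hh'
    have hb := danskin_tendsto_payoff q g hLμ hLh hμs hhs hhsS hbarS
    exact le_of_tendsto_of_tendsto' ha hb fun n => hmaxn n h' hh'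
  refine ⟨hmax, ?_⟩
  obtain ⟨h₁, hh₁S, hh₁max, hh₁eq⟩ := danskin_exists_max q g hH hLh μ₀
  rw [hh₁eq]
  exact le_antisymm (hmax h₁ hh₁S) (hh₁max hbar hbarS)

/-! ### One-sided upper bounds by compactness + convexity -/

/-- **Right upper bound.** Under the Danskin hypotheses, for every `ε > 0` there is `ρ > 0` with
`B(μ) − B(μ₀) ≤ (d + ε)(μ − μ₀)` for `μ₀ < μ < μ₀ + ρ`. [folklore] -/
theorem danskin_right_upper (q : ℝ → ℝ → ℝ) {H Cμ Ch : ℝ} (g : ℝ) {μ₀ d : ℝ} (hH : 0 ≤ H)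
    (hconv : ∀ h ∈ Set.Icc (-H) H, ConvexOn ℝ Set.univ (fun μ => q μ h))
    (hLμ : ∀ (μ μ' : ℝ), ∀ h ∈ Set.Icc (-H) H, |q μ h - q μ' h| ≤ Cμ * |μ - μ'|)
    (hLh : ∀ (μ : ℝ), ∀ h ∈ Set.Icc (-H) H, ∀ h' ∈ Set.Icc (-H) H, |q μ h - q μ h'| ≤ Ch * |h - h'|)
    (hmax : ∀ h ∈ Set.Icc (-H) H,
      q μ₀ h - h ^ 2 / g = sSup ((fun h' : ℝ => q μ₀ h' - h' ^ 2 / g) '' Set.Icc (-H) H) →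
        HasDerivAt (fun μ => q μ h) d μ₀) :
    ∀ ε : ℝ, 0 < ε → ∃ ρ : ℝ, 0 < ρ ∧ ∀ μ : ℝ, μ₀ < μ → μ < μ₀ + ρ →
      sSup ((fun h' : ℝ => q μ h' - h' ^ 2 / g) '' Set.Icc (-H) H) -
          sSup ((fun h' : ℝ => q μ₀ h' - h' ^ 2 / g) '' Set.Icc (-H) H) ≤ (d + ε) * (μ - μ₀) := by
  intro ε hε
  by_contra hcon
  push Not at hcon
  -- a bad sequence `μₙ ↓ μ₀`
  choose μs hμs_gt hμs_lt hμs_bad using fun n : ℕ => hcon (1 / ((n : ℝ) + 1)) (by positivity)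
  -- maximisers at `μₙ`
  choose hs hhsS hhs_max hhs_eq using fun n => danskin_exists_max q g hH hLh (μs n)
  obtain ⟨hbar, hbarS, φ, hφ, hlim⟩ := isCompact_Icc.tendsto_subseq (x := hs) fun n => hhsS n
  -- `μ_{φ n} → μ₀`
  have hμlim : Tendsto (μs ∘ φ) atTop (𝓝 μ₀) := by
    have h0' : Tendsto (fun n : ℕ => 1 / (((φ n : ℕ) : ℝ) + 1)) atTop (𝓝 0) :=
      tendsto_one_div_add_atTop_nhds_zero_nat.comp hφ.tendsto_atTop
    have hup : Tendsto (fun n : ℕ => μ₀ + 1 / (((φ n : ℕ) : ℝ) + 1)) atTop (𝓝 μ₀) := by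
      simpa using tendsto_const_nhds.add h0'
    refine tendsto_of_tendsto_of_tendsto_of_le_of_le tendsto_const_nhds hup (fun n => ?_) fun n => ?_
    · exact (hμs_gt (φ n)).le
    · exact (hμs_lt (φ n)).le
  -- `h̄` is a maximiser at `μ₀`, hence the derivative hypothesis applies to it
  obtain ⟨hbar_max, hbar_eq⟩ := danskin_limit_isMax q g hH hLμ hLh hμlim hlim (fun n => hhsS (φ n))
    hbarS fun n => hhs_max (φ n)
  have hD : HasDerivAt (fun μ => q μ hbar) d μ₀ := hmax hbar hbarS hbar_eq.symm
  -- a small step `τ` with secant `< d + ε/2` over `[μ₀, μ₀ + τ]`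
  rw [hasDerivAt_iff_tendsto_slope, Metric.tendsto_nhdsWithin_nhds] at hD
  obtain ⟨τ₀, hτ₀, hτ⟩ := hD (ε / 2) (half_pos hε)
  set τ : ℝ := τ₀ / 2 with hτdef
  have hτpos : 0 < τ := by positivity
  have hsec : (q (μ₀ + τ) hbar - q μ₀ hbar) / τ < d + ε / 2 := by
    have hne : μ₀ + τ ∈ ({μ₀}ᶜ : Set ℝ) := by
      simp only [Set.mem_compl_iff, Set.mem_singleton_iff]; linarith
    have hdist : dist (μ₀ + τ) μ₀ < τ₀ := by
      rw [Real.dist_eq, show μ₀ + τ - μ₀ = τ by ring, abs_of_pos hτpos]; linarith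
    have := hτ hne hdist
    rw [slope_def_field, show μ₀ + τ - μ₀ = τ by ring, Real.dist_eq, abs_lt] at this
    linarith [this.2]
  -- choose `n` large: `μ_{φ n} − μ₀ < τ` and the `h`-Lipschitz error is `< ε/2`
  set K : ℝ := max Ch 0 + 1 with hKdef
  have hK0 : 0 < K := by positivity
  rw [Metric.tendsto_atTop] at hμlim hlim
  obtain ⟨N₁, hN₁⟩ := hμlim τ hτpos
  obtain ⟨N₂, hN₂⟩ := hlim (ε * τ / (4 * K)) (by positivity)
  set n := max N₁ N₂ with hndef
  have h1 : |μs (φ n) - μ₀| < τ := by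
    have := hN₁ n (le_max_left _ _); rwa [Real.dist_eq] at this
  have h2 : |hs (φ n) - hbar| < ε * τ / (4 * K) := by
    have := hN₂ n (le_max_right _ _); rwa [Real.dist_eq] at this
  set μ := μs (φ n) with hμdef
  set h := hs (φ n) with hhdef
  have hμgt : μ₀ < μ := hμs_gt (φ n)
  have hμτ : μ ≤ μ₀ + τ := by rw [abs_lt] at h1; linarith [h1.2]
  have hhS : h ∈ Set.Icc (-H) H := hhsS (φ n)
  -- (1) `B(μ) − B(μ₀) ≤ q μ h − q μ₀ h`
  have hB0 : q μ₀ h - h ^ 2 / g ≤ sSup ((fun h' : ℝ => q μ₀ h' - h' ^ 2 / g) '' Set.Icc (-H) H) := by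
    rw [hbar_eq]; exact hbar_max h hhS
  have hstep1 : sSup ((fun h' : ℝ => q μ h' - h' ^ 2 / g) '' Set.Icc (-H) H) -
      sSup ((fun h' : ℝ => q μ₀ h' - h' ^ 2 / g) '' Set.Icc (-H) H) ≤ q μ h - q μ₀ h := by
    rw [hhs_eq (φ n)]; linarith
  -- (2) convexity: secant over `[μ₀, μ]` ≤ secant over `[μ₀, μ₀ + τ]`
  have hstep2 : (q μ h - q μ₀ h) / (μ - μ₀) ≤ (q (μ₀ + τ) h - q μ₀ h) / τ := by
    have := (hconv h hhS).secant_mono (a := μ₀) (x := μ) (y := μ₀ + τ) (Set.mem_univ _)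
      (Set.mem_univ _) (Set.mem_univ _) (ne_of_gt hμgt) (by linarith) hμτ
    rwa [show μ₀ + τ - μ₀ = τ by ring] at this
  -- (3) `h`-Lipschitz: secant at `h` ≤ secant at `h̄` + 2K|h − h̄|/τ
  have hstep3 : (q (μ₀ + τ) h - q μ₀ h) / τ ≤ (q (μ₀ + τ) hbar - q μ₀ hbar) / τ + ε / 2 := by
    have ha := hLh (μ₀ + τ) h hhS hbar hbarS
    have hb := hLh μ₀ h hhS hbar hbarS
    have hCh : Ch * |h - hbar| ≤ K * |h - hbar| := by
      apply mul_le_mul_of_nonneg_right _ (abs_nonneg _); linarith [le_max_left Ch 0]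
    have hKe : K * |h - hbar| < ε * τ / 4 := by
      calc K * |h - hbar| < K * (ε * τ / (4 * K)) := mul_lt_mul_of_pos_left h2 hK0
        _ = ε * τ / 4 := by field_simp
    rw [abs_le] at ha hb
    rw [div_le_iff₀ hτpos, add_mul, div_mul_cancel₀ _ hτpos.ne']
    nlinarith [ha.1, ha.2, hb.1, hb.2, hKe, hCh]
  -- combine: `B(μ) − B(μ₀) ≤ (d + ε)(μ − μ₀)`, contradicting the choice of `μ`
  have hpos : 0 < μ - μ₀ := by linarith
  have hquot : (q μ h - q μ₀ h) / (μ - μ₀) < d + ε := by linarith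
  have hfinal : q μ h - q μ₀ h < (d + ε) * (μ - μ₀) := by
    rwa [div_lt_iff₀ hpos] at hquot
  have hbad := hμs_bad (φ n)
  linarith

/-- **Left upper bound.** Under the Danskin hypotheses, for every `ε > 0` there is `ρ > 0` with
`B(μ) − B(μ₀) ≤ (d − ε)(μ − μ₀)` for `μ₀ − ρ < μ < μ₀` (i.e. the left difference quotient is
`≥ d − ε`). [folklore] -/
theorem danskin_left_upper (q : ℝ → ℝ → ℝ) {H Cμ Ch : ℝ} (g : ℝ) {μ₀ d : ℝ} (hH : 0 ≤ H)
    (hconv : ∀ h ∈ Set.Icc (-H) H, ConvexOn ℝ Set.univ (fun μ => q μ h))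
    (hLμ : ∀ (μ μ' : ℝ), ∀ h ∈ Set.Icc (-H) H, |q μ h - q μ' h| ≤ Cμ * |μ - μ'|)
    (hLh : ∀ (μ : ℝ), ∀ h ∈ Set.Icc (-H) H, ∀ h' ∈ Set.Icc (-H) H, |q μ h - q μ h'| ≤ Ch * |h - h'|)
    (hmax : ∀ h ∈ Set.Icc (-H) H,
      q μ₀ h - h ^ 2 / g = sSup ((fun h' : ℝ => q μ₀ h' - h' ^ 2 / g) '' Set.Icc (-H) H) →
        HasDerivAt (fun μ => q μ h) d μ₀) :
    ∀ ε : ℝ, 0 < ε → ∃ ρ : ℝ, 0 < ρ ∧ ∀ μ : ℝ, μ₀ - ρ < μ → μ < μ₀ →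
      sSup ((fun h' : ℝ => q μ h' - h' ^ 2 / g) '' Set.Icc (-H) H) -
          sSup ((fun h' : ℝ => q μ₀ h' - h' ^ 2 / g) '' Set.Icc (-H) H) ≤ (d - ε) * (μ - μ₀) := by
  intro ε hε
  by_contra hcon
  push Not at hcon
  choose μs hμs_gt hμs_lt hμs_bad using fun n : ℕ => hcon (1 / ((n : ℝ) + 1)) (by positivity)
  choose hs hhsS hhs_max hhs_eq using fun n => danskin_exists_max q g hH hLh (μs n)
  obtain ⟨hbar, hbarS, φ, hφ, hlim⟩ := isCompact_Icc.tendsto_subseq (x := hs) fun n => hhsS n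
  have hμlim : Tendsto (μs ∘ φ) atTop (𝓝 μ₀) := by
    have h0' : Tendsto (fun n : ℕ => 1 / (((φ n : ℕ) : ℝ) + 1)) atTop (𝓝 0) :=
      tendsto_one_div_add_atTop_nhds_zero_nat.comp hφ.tendsto_atTop
    have hdown : Tendsto (fun n : ℕ => μ₀ - 1 / (((φ n : ℕ) : ℝ) + 1)) atTop (𝓝 μ₀) := by
      simpa using tendsto_const_nhds.sub h0'
    refine tendsto_of_tendsto_of_tendsto_of_le_of_le hdown tendsto_const_nhds (fun n => ?_) fun n => ?_
    · exact (hμs_gt (φ n)).le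
    · exact (hμs_lt (φ n)).le
  obtain ⟨hbar_max, hbar_eq⟩ := danskin_limit_isMax q g hH hLμ hLh hμlim hlim (fun n => hhsS (φ n))
    hbarS fun n => hhs_max (φ n)
  have hD : HasDerivAt (fun μ => q μ hbar) d μ₀ := hmax hbar hbarS hbar_eq.symm
  rw [hasDerivAt_iff_tendsto_slope, Metric.tendsto_nhdsWithin_nhds] at hD
  obtain ⟨τ₀, hτ₀, hτ⟩ := hD (ε / 2) (half_pos hε)
  set τ : ℝ := τ₀ / 2 with hτdef
  have hτpos : 0 < τ := by positivity
  -- secant over `[μ₀ − τ, μ₀]` is `> d − ε/2`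
  have hsec : d - ε / 2 < (q (μ₀ - τ) hbar - q μ₀ hbar) / (-τ) := by
    have hne : μ₀ - τ ∈ ({μ₀}ᶜ : Set ℝ) := by
      simp only [Set.mem_compl_iff, Set.mem_singleton_iff]; linarith
    have hdist : dist (μ₀ - τ) μ₀ < τ₀ := by
      rw [Real.dist_eq, show μ₀ - τ - μ₀ = -τ by ring, abs_neg, abs_of_pos hτpos]; linarith
    have := hτ hne hdist
    rw [slope_def_field, show μ₀ - τ - μ₀ = -τ by ring, Real.dist_eq, abs_lt] at this
    linarith [this.1]
  set K : ℝ := max Ch 0 + 1 with hKdef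
  have hK0 : 0 < K := by positivity
  rw [Metric.tendsto_atTop] at hμlim hlim
  obtain ⟨N₁, hN₁⟩ := hμlim τ hτpos
  obtain ⟨N₂, hN₂⟩ := hlim (ε * τ / (4 * K)) (by positivity)
  set n := max N₁ N₂ with hndef
  have h1 : |μs (φ n) - μ₀| < τ := by
    have := hN₁ n (le_max_left _ _); rwa [Real.dist_eq] at this
  have h2 : |hs (φ n) - hbar| < ε * τ / (4 * K) := by
    have := hN₂ n (le_max_right _ _); rwa [Real.dist_eq] at this
  set μ := μs (φ n) with hμdef
  set h := hs (φ n) with hhdef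
  have hμlt : μ < μ₀ := hμs_lt (φ n)
  have hμτ : μ₀ - τ ≤ μ := by rw [abs_lt] at h1; linarith [h1.1]
  have hhS : h ∈ Set.Icc (-H) H := hhsS (φ n)
  have hB0 : q μ₀ h - h ^ 2 / g ≤ sSup ((fun h' : ℝ => q μ₀ h' - h' ^ 2 / g) '' Set.Icc (-H) H) := by
    rw [hbar_eq]; exact hbar_max h hhS
  have hstep1 : sSup ((fun h' : ℝ => q μ h' - h' ^ 2 / g) '' Set.Icc (-H) H) -
      sSup ((fun h' : ℝ => q μ₀ h' - h' ^ 2 / g) '' Set.Icc (-H) H) ≤ q μ h - q μ₀ h := by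
    rw [hhs_eq (φ n)]; linarith
  -- convexity: secant over `[μ₀ − τ, μ₀]` ≤ secant over `[μ, μ₀]` (common right end point `μ₀`)
  have hstep2 : (q (μ₀ - τ) h - q μ₀ h) / (μ₀ - τ - μ₀) ≤ (q μ h - q μ₀ h) / (μ - μ₀) :=
    (hconv h hhS).secant_mono (a := μ₀) (x := μ₀ - τ) (y := μ) (Set.mem_univ _)
      (Set.mem_univ _) (Set.mem_univ _) (by linarith) (ne_of_lt hμlt) hμτ
  rw [show μ₀ - τ - μ₀ = -τ by ring] at hstep2
  -- `h`-Lipschitz at the two points `μ₀ − τ`, `μ₀`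
  have hstep3 : (q (μ₀ - τ) hbar - q μ₀ hbar) / (-τ) - ε / 2 ≤ (q (μ₀ - τ) h - q μ₀ h) / (-τ) := by
    have ha := hLh (μ₀ - τ) h hhS hbar hbarS
    have hb := hLh μ₀ h hhS hbar hbarS
    have hCh : Ch * |h - hbar| ≤ K * |h - hbar| := by
      apply mul_le_mul_of_nonneg_right _ (abs_nonneg _); linarith [le_max_left Ch 0]
    have hKe : K * |h - hbar| < ε * τ / 4 := by
      calc K * |h - hbar| < K * (ε * τ / (4 * K)) := mul_lt_mul_of_pos_left h2 hK0
        _ = ε * τ / 4 := by field_simp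
    rw [abs_le] at ha hb
    have hnegτ : -τ < 0 := by linarith
    rw [div_sub' (ne_of_lt hnegτ), div_le_div_right_of_neg hnegτ]
    nlinarith [ha.1, ha.2, hb.1, hb.2, hKe, hCh]
  -- combine: the left quotient is `> d − ε`, contradicting the choice of `μ`
  have hneg : μ - μ₀ < 0 := by linarith
  have hquot : d - ε < (q μ h - q μ₀ h) / (μ - μ₀) := by linarith
  have hfinal : q μ h - q μ₀ h < (d - ε) * (μ - μ₀) := by
    rwa [lt_div_iff_of_neg hneg] at hquot
  have hbad := hμs_bad (φ n)
  linarith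

/-! ### The envelope theorem -/

/-- **Convex Danskin / envelope theorem** (hypothesis form). [folklore: Danskin 1966;
Hiriart-Urruty–Lemaréchal I, Thm VI.4.4.2] -/
theorem danskin_hasDerivAt (q : ℝ → ℝ → ℝ) {H Cμ Ch : ℝ} (g : ℝ) {μ₀ d : ℝ} (hH : 0 ≤ H)
    (hconv : ∀ h ∈ Set.Icc (-H) H, ConvexOn ℝ Set.univ (fun μ => q μ h))
    (hLμ : ∀ (μ μ' : ℝ), ∀ h ∈ Set.Icc (-H) H, |q μ h - q μ' h| ≤ Cμ * |μ - μ'|)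
    (hLh : ∀ (μ : ℝ), ∀ h ∈ Set.Icc (-H) H, ∀ h' ∈ Set.Icc (-H) H, |q μ h - q μ h'| ≤ Ch * |h - h'|)
    (hmax : ∀ h ∈ Set.Icc (-H) H,
      q μ₀ h - h ^ 2 / g = sSup ((fun h' : ℝ => q μ₀ h' - h' ^ 2 / g) '' Set.Icc (-H) H) →
        HasDerivAt (fun μ => q μ h) d μ₀) :
    HasDerivAt (fun μ => sSup ((fun h' : ℝ => q μ h' - h' ^ 2 / g) '' Set.Icc (-H) H)) d μ₀ := by
  set B : ℝ → ℝ := fun μ => sSup ((fun h' : ℝ => q μ h' - h' ^ 2 / g) '' Set.Icc (-H) H) with hBdef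
  -- one maximiser `h₀` at `μ₀` gives the lower bounds
  obtain ⟨h₀, hh₀S, hh₀max, hh₀eq⟩ := danskin_exists_max q g hH hLh μ₀
  have hD₀ : HasDerivAt (fun μ => q μ h₀) d μ₀ := hmax h₀ hh₀S hh₀eq.symm
  have hlow : ∀ μ : ℝ, q μ h₀ - q μ₀ h₀ ≤ B μ - B μ₀ := by
    intro μ
    obtain ⟨h₁, hh₁S, hh₁max, hh₁eq⟩ := danskin_exists_max q g hH hLh μ
    have h1 : q μ h₀ - h₀ ^ 2 / g ≤ B μ := by
      show q μ h₀ - h₀ ^ 2 / g ≤ sSup ((fun h' : ℝ => q μ h' - h' ^ 2 / g) '' Set.Icc (-H) H)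
      rw [hh₁eq]; exact hh₁max h₀ hh₀S
    have h2 : B μ₀ = q μ₀ h₀ - h₀ ^ 2 / g := hh₀eq
    linarith
  rw [hasDerivAt_iff_tendsto_slope, Metric.tendsto_nhdsWithin_nhds]
  intro ε hε
  rw [hasDerivAt_iff_tendsto_slope, Metric.tendsto_nhdsWithin_nhds] at hD₀
  obtain ⟨δ₁, hδ₁, hslope₀⟩ := hD₀ ε hε
  obtain ⟨ρ₂, hρ₂, hR⟩ := danskin_right_upper q g hH hconv hLμ hLh hmax (ε / 2) (half_pos hε)
  obtain ⟨ρ₃, hρ₃, hL⟩ := danskin_left_upper q g hH hconv hLμ hLh hmax (ε / 2) (half_pos hε)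
  refine ⟨min δ₁ (min ρ₂ ρ₃), by positivity, fun {μ} hμne hμdist => ?_⟩
  have hμne' : μ ≠ μ₀ := by simpa using hμne
  have hd1 : dist μ μ₀ < δ₁ := lt_of_lt_of_le hμdist (min_le_left _ _)
  have hd2 : |μ - μ₀| < ρ₂ :=
    lt_of_lt_of_le (by rwa [Real.dist_eq] at hμdist) ((min_le_right _ _).trans (min_le_left _ _))
  have hd3 : |μ - μ₀| < ρ₃ :=
    lt_of_lt_of_le (by rwa [Real.dist_eq] at hμdist) ((min_le_right _ _).trans (min_le_right _ _))
  have hs₀ := hslope₀ hμne hd1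
  rw [slope_def_field, Real.dist_eq, abs_lt] at hs₀
  rw [slope_def_field, Real.dist_eq, abs_lt]
  rcases lt_or_gt_of_ne hμne' with hlt | hgt
  · -- `μ < μ₀`
    have hneg : μ - μ₀ < 0 := by linarith
    rw [abs_lt] at hd3
    have hup := hL μ (by linarith [hd3.1]) hlt
    have hlo := hlow μ
    constructor
    · -- quotient ≥ d − ε/2 > d − ε
      have : d - ε / 2 ≤ (B μ - B μ₀) / (μ - μ₀) := by
        rw [le_div_iff_of_neg hneg]; linarith
      linarith
    · -- quotient ≤ quotient of `q · h₀` < d + ε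
      have : (B μ - B μ₀) / (μ - μ₀) ≤ (q μ h₀ - q μ₀ h₀) / (μ - μ₀) :=
        div_le_div_of_nonpos_of_le hneg.le hlo
      linarith [hs₀.2]
  · -- `μ₀ < μ`
    have hpos : 0 < μ - μ₀ := by linarith
    rw [abs_lt] at hd2
    have hup := hR μ hgt (by linarith [hd2.2])
    have hlo := hlow μ
    constructor
    · have : (q μ h₀ - q μ₀ h₀) / (μ - μ₀) ≤ (B μ - B μ₀) / (μ - μ₀) :=
        div_le_div_of_nonneg_right hlo hpos.le
      linarith [hs₀.1]
    · have : (B μ - B μ₀) / (μ - μ₀) ≤ d + ε / 2 := by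
        rw [div_le_iff₀ hpos]; linarith
      linarith

/-- **S1 (registered stub of line `Sketch`, crux stmt-HubbardSuperconductivity-15581): the convex Danskin /
envelope theorem** for `B(μ) = sSup_{|h| ≤ H} [q μ h − h²/g]`: convex in `μ` for each `h`, jointly
Lipschitz, all maximisers at `μ₀` differentiable in `μ` with a common slope `d` ⟹ `HasDerivAt B d μ₀`.
[folklore: Danskin 1966; Hiriart-Urruty–Lemaréchal, Convex Analysis and Minimization Algorithms I,
Thm VI.4.4.2] -/
theorem stub_danskinEnvelope :
    ∀ (q : ℝ → ℝ → ℝ) (H g Cμ Ch μ₀ d : ℝ), 0 ≤ H →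
      (∀ h ∈ Set.Icc (-H) H, ConvexOn ℝ Set.univ (fun μ => q μ h)) →
      (∀ (μ μ' : ℝ), ∀ h ∈ Set.Icc (-H) H, |q μ h - q μ' h| ≤ Cμ * |μ - μ'|) →
      (∀ (μ : ℝ), ∀ h ∈ Set.Icc (-H) H, ∀ h' ∈ Set.Icc (-H) H, |q μ h - q μ h'| ≤ Ch * |h - h'|) →
      (∀ h ∈ Set.Icc (-H) H,
        q μ₀ h - h ^ 2 / g = sSup ((fun h' : ℝ => q μ₀ h' - h' ^ 2 / g) '' Set.Icc (-H) H) →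
          HasDerivAt (fun μ => q μ h) d μ₀) →
      HasDerivAt (fun μ => sSup ((fun h' : ℝ => q μ h' - h' ^ 2 / g) '' Set.Icc (-H) H)) d μ₀ := by
  intro q H g Cμ Ch μ₀ d hH hconv hLμ hLh hmax
  exact danskin_hasDerivAt q g hH hconv hLμ hLh hmax

end

end Summit.HubbardSuperconductivity.HubbardSuperconductivity.Theorems.TwSeededEnsembleEquivalenceR.ColdFloorLine
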